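import Summits.QuantumFields.BalabanUV.Beta.FP.TowerQN2RowFamily
import Summits.QuantumFields.BalabanUV.Beta.FP.TowerHN2RowDoor
import Summits.QuantumFields.BalabanUV.Beta.FP.TowerSigmaLegLetters
import Summits.QuantumFields.BalabanUV.Beta.FP.WoundEvenFamilyParities
import Summits.QuantumFields.BalabanUV.Beta.FP.TowerNParityRowsEven
import Summits.QuantumFields.BalabanUV.Beta.NVertexEvenChartGenericTorusG
import Summits.QuantumFields.BalabanUV.Beta.FP.TowerQN2ReadersChartGeneric
import Summits.QuantumFields.BalabanUV.Beta.NVertexChartGenericObjectsG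

/-!
# `BalabanUV.Beta.FP.TowerEvenReadersChartGenericG` — road «FP» σ_T XREAD: the GRADED TWIN of `FP.TowerEvenReadersChartGeneric` under {`tabsComp ↦ tabsCompG`, `WNA ↦ WNAG`, `WNs ↦ WNsG`} (director-ym g23 [DIRYM-G23-INBOX-9]
# ruling (1) «located repair σ_T»; census `S-END-G-CENSUS-g73.md` §6 ∕ FP-87); statements = the original's under the token map, proofs VERBATIM; every chain supplier re-pointed to its `…G` twin;
# record-level mixed-table letters re-pointed to an2's `NVertexGradedRecordLetters` (`exists_locStencilFM_M2NG(_even)`, `M2NG_even_translate`, `periodCov_M2NG_even`, `tabsCompG_M_apply`) and F-L8-G's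
# `compMixG_inr` ∕ `M2NG_even_apply_inr_inl`.  Nothing of Bałaban's asserted (ABSOLUTE RULE); 0 estimates; 0∕4 row-D1 binders; `hlawLG` OPEN by name; NOT (C1), NOT (T-ID), NOT SDF, NOT D1,
# NEVER «G-an2-4 closed», NOT BetaPertH, NOT continuum, NOT Clay.

HONEST DEPENDENCY (page 1, mandatory): continuum YM on T⁴ ⇐ BetaPertH ∧ nine spine estimates (0/9 proved); BetaPertH ⇐ (D1) ∧ (D4) ∧ CAP+tail;
G-an2-4 gates asym, D1 and NE2/3/4.  HONEST FRAMING (cell contract, verbatim): «discharging `BetaPertH` makes Bałaban's UV stability UNCONDITIONAL —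
a real constructive-QFT result; it is NOT the continuum limit and NOT the Clay problem.»  ABSOLUTE RULE (cell charter, verbatim): «No internally-minted
statement may enter as a cited fact. Every hypothesis is either kernel-proved in this package or a verbatim quotation of a PUBLISHED theorem with page
reference. The manuscript(s) under audit are NOT citable for their own disputed steps — they are the thing under adjudication; programme-internal
(2001/route/tribunal) claims are never citable.»  Road «FP» OWNER, b2b-balaban-beta-d1-p3 gen 73 (xread) ∕ gen 74 (filing), 2026-08-31 (σ_T; generator `HOME/b2b-balaban-beta-d1-p3/g73/xread-sigmaT/sigmaT.py`; the row's six σ_T modules imported BY NAME from the tree).  No existing file touched.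
-/

noncomputable section

open scoped BigOperators Matrix

namespace Summit.QuantumFields.BalabanUV.Beta.FP.TowerEvenReadersChartGenericG.EvenJets

/-! ## 11e `TowerNParityRowsEven` §1 record letters at `WNAG` -/

open Literature.MathematicalPhysics.QuantumFieldTheory.Balaban1983to89 Literature.MathematicalPhysics.QuantumFieldTheory.Balaban1983to89.Beta
open B5Prop11Plancherel (fine)  open B6Lemma24Torus (pbox)
open AffineAveraging (Site)  open ExpKernelCalculus (MKer VertexFamily VertexFamily₂ hessKer)  open OneStepResolventKernel (Fib)
open SecondOrderResponse (W2SymOfK_swap)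
open Summit.QuantumFields.BalabanUV.Beta.TameKernelCalculus (Spr trK)
open Summit.QuantumFields.BalabanUV.Beta.BorderedHessian (sgnK)
open Summit.QuantumFields.BalabanUV.Beta.CompositeOneShotJetData (Roots Pins AN VN WN)
open Summit.QuantumFields.BalabanUV.Beta.NVertexSectors (decays_AN)
open Summit.QuantumFields.BalabanUV.Beta.NVertexParities (vertexFamilies_VN_WN)
open Summit.QuantumFields.BalabanUV.Beta.NVertexParitiesW (WN_eq_W2SymOfK)
open Summit.QuantumFields.BalabanUV.Beta.GAN24.SecondOrderCarrierParity (vertexFamily₂_evenHalf_of_swap)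
open Summit.QuantumFields.BalabanUV.Beta.FP.KernelPeriodisationFib (Idx perF)
open Summit.QuantumFields.BalabanUV.Beta.FP.KernelPeriodisationFibLoc (dper)
open Summit.QuantumFields.BalabanUV.Beta.FP.TorusCompositeObjects (towerTorus)
open Summit.QuantumFields.BalabanUV.Beta.FP.TowerNParityRows (exists_NN_rows)
open Summit.QuantumFields.BalabanUV.Beta.FP.TowerNParityRowsW (hWNm_rows)
open Summit.QuantumFields.BalabanUV.Beta.FP.CompositeOneShotChartParity (trK_AN)
open Summit.QuantumFields.BalabanUV.Beta.FP.SecondOrderTableEvenPart (hessKer_evenHalf perF_dper_evenHalf_mm perF_dper_evenHalf_antitwin_fμ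
  perF_dper_evenHalf_submatrix_ff perF_dper_evenHalf_submatrix_μf)

open ExpKernelCalculus (MKer Decays shiftK VertexFamily₂)
open Summit.QuantumFields.BalabanUV.Beta.TameKernelCalculus (trK)
open Summit.QuantumFields.BalabanUV.Beta.BorderedHessian (sgnK)
open Summit.QuantumFields.BalabanUV.Beta.NVertexChartGenericObjectsG (WNAG WNAG_eq)
open Summit.QuantumFields.BalabanUV.Beta.NVertexEvenChartGenericBorderG (WNAG_eq_W2SymOfK vertexFamily₂_WNAG)
open Summit.QuantumFields.BalabanUV.Beta.AxialDressingRooted (one_le_of_neZero)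
open Summit.QuantumFields.BalabanUV.Beta.CompositeOneShotJetsGraded (tabsCompG)

section Record

variable {Lc : ℕ} [NeZero Lc] (R : Roots Lc) (P : Pins) (A : MKer (3 + 1) (Fib 3)) (j : ℕ) (hA : ∃ δ C : ℝ, 0 < δ ∧ 0 ≤ C ∧ Decays A C δ)

/-- [folklore] v4's §1 `WN_swap` at the generic family: it is symmetric under the swap of its two labelled legs (RZ `WNAG_eq_W2SymOfK` + lit `W2SymOfK_swap`). CLASS ∅. -/
theorem WN_swapA (μ : Fin (3 + 1)) (y : Site (3 + 1)) (ν : Fin (3 + 1)) (y' : Site (3 + 1)) : WNAG R P A j ν y' μ y = WNAG R P A j μ y ν y' := by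
  rw [WNAG_eq_W2SymOfK]
  exact W2SymOfK_swap _ _ _ _ _ _ μ y ν y'

include hA in
/-- [folklore] v4's §1 `exists_biLoc_WN` at the generic family: every member is bi-localised at its two coarse bonds with a NONNEGATIVE constant and a positive rate (RZ v1.1 §M `vertexFamily₂_WNAG`). CLASS {hA}. -/
theorem exists_biLoc_WNAG (μ : Fin (3 + 1)) (y : Site (3 + 1)) (ν : Fin (3 + 1)) (y' : Site (3 + 1)) :
    ∃ C δ : ℝ, 0 ≤ C ∧ 0 < δ ∧ ExpKernelCalculus.BiLoc (WNAG R P A j μ y ν y') (((Lc ^ (j + 1) : ℕ) : ℤ) • y) (((Lc ^ (j + 1) : ℕ) : ℤ) • y') C δ := by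
  obtain ⟨Cw, δ, hδ, hW⟩ := vertexFamily₂_WNAG R P A j hA
  exact ⟨Cw, δ, (hW μ y ν y').nonneg (Sum.inl 0), hδ, hW μ y ν y'⟩

end Record

end Summit.QuantumFields.BalabanUV.Beta.FP.TowerEvenReadersChartGenericG.EvenJets

namespace Summit.QuantumFields.BalabanUV.Beta.FP.TowerEvenReadersChartGenericG.QN2Lock

/-! ## 11a `TowerQN2Row` §Row at `A` ∕ `WNAG` -/

open Finset Matrix
open Literature.MathematicalPhysics.QuantumFieldTheory
open Literature.MathematicalPhysics.QuantumFieldTheory.Balaban1983to89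
open Literature.MathematicalPhysics.QuantumFieldTheory.Balaban1983to89.Beta
open B4TorusKernel.MultiPeriod (translate)
open B5Prop11Plancherel (fine)
open B6Lemma24Torus (pbox)
open AffineAveraging (Site box toSite)
open AveragingContoursRooted (ctr ctrOff)
open AveragingHessianKernels (packVH)
open ExpKernelCalculus (MKer)
open OneStepResolventKernel (Fib)
open Summit.QuantumFields.BalabanUV.Beta.TameKernelCalculus (trK)
open Summit.QuantumFields.BalabanUV.Beta.BorderedHessian (sgnK)
open Summit.QuantumFields.BalabanUV.Beta.BorderedHessian (stepScale)
open Summit.QuantumFields.BalabanUV.Beta.SymAveragingHessianCounts (symLinKerAt symVhKerAt)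
open Summit.QuantumFields.BalabanUV.Beta.SymAveragingMixedJetTables (symVh2KerAt)
open Summit.QuantumFields.BalabanUV.Beta.CompositeVertexKernelRec (compVH2Ker compVh2S)
open Summit.QuantumFields.BalabanUV.Beta.CompositeVertexKernelBoundsTwoSym (symVh2KerSymAt)
open Summit.QuantumFields.BalabanUV.Beta.CompositeOneShotJetData (Roots Pins AN WN)
open Summit.QuantumFields.BalabanUV.Beta.FP.KernelPeriodisationFib (Idx perF)
open Summit.QuantumFields.BalabanUV.Beta.FP.KernelPeriodisationFibLoc (dper)
open Summit.QuantumFields.BalabanUV.Beta.FP.TorusGaugeCovariance (tgrad)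
open Summit.QuantumFields.BalabanUV.Beta.FP.TorusGaugeCovariancePairing (wrapPt)
open Summit.QuantumFields.BalabanUV.Beta.FP.TorusCompositeObjects (towerTorus)
open Summit.QuantumFields.BalabanUV.Beta.FP.TorusCompositeCovariance (itRoot)
open Summit.QuantumFields.BalabanUV.Beta.FP.TorusCompositeObjectsG (compRowsSym)
open Summit.QuantumFields.BalabanUV.Beta.FP.TorusCompositeCovarianceOneSym (compIns₁Sym)
open Summit.QuantumFields.BalabanUV.Beta.FP.TorusCompositeCovarianceTwoPolarSym (compIns₂₂Sym)
open Summit.QuantumFields.BalabanUV.Beta.FP.TowerQN2RowCopies (towerTorus_fine_apply Qprime2_symm_apply_eq_sum_sum_perF_dper_copies)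
open Summit.QuantumFields.BalabanUV.Beta.NVertexEvenBorderTorus (perF_dper_wound_WN_evenHalf_inr_inl_eq_sum)

open ExpKernelCalculus (MKer Decays shiftK VertexFamily₂)
open Summit.QuantumFields.BalabanUV.Beta.TameKernelCalculus (trK)
open Summit.QuantumFields.BalabanUV.Beta.BorderedHessian (sgnK)
open Summit.QuantumFields.BalabanUV.Beta.NVertexChartGenericObjectsG (WNAG)
open Summit.QuantumFields.BalabanUV.Beta.NVertexEvenChartGenericCarrierPeriodisedG (perF_dper_wound_WNAG_evenHalf_inr_inl_eq_sum)
open Summit.QuantumFields.BalabanUV.Beta.FP.TowerQN2ReadersChartGeneric.Copies (Qprime2_symm_apply_eq_sum_sum_perF_dper_copiesA)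

section Row

variable {Lc : ℕ} [NeZero Lc] (M : Fin (3 + 1) → ℕ) [∀ μ, NeZero (M μ)] (n : ℕ) (c : ℝ) (Pn : Pins) (A : MKer (3 + 1) (Fib 3))
  (hA : ∃ δ C : ℝ, 0 < δ ∧ 0 ≤ C ∧ Decays A C δ) (hAσ : trK A = sgnK A) (hAt : ∀ t : Fin (3 + 1) → ℤ, shiftK (-(((Lc ^ (n + 1 + 1) : ℕ) : ℤ) • t)) A = A)
  -- (H) `TowerQN2RowCopies` §2's letters VERBATIM: the slot map, the root, the labels, #6's 𝔔-side namings, the pinned directions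
variable (fN : (↥(pbox M) × Fin (3 + 1)) → Idx (towerTorus Lc (fine Lc M) (n + 1)) (Fib 3))
  (hfN : ∀ a : ↥(pbox M) × Fin (3 + 1),
    fN a = (wrapPt (towerTorus Lc (fine Lc M) (n + 1)) (((Lc ^ (n + 1 + 1) : ℕ) : ℤ) • (a.1 : Site (3 + 1))), Sum.inr a.2))
variable (hc : ctrOff (3 + 1) Lc ∈ box (3 + 1) Lc)
  {κ : Type*} [Fintype κ] [DecidableEq κ] (yN : κ → Site (3 + 1)) (μN : κ → Fin (3 + 1))
  (hv : (κ → ℝ) → (↥(pbox (towerTorus Lc (fine Lc M) (n + 1))) × Fin (3 + 1) → ℝ))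
  (hhvl : ∀ (r : ℝ) (x y : κ → ℝ), hv (r • x + y) = r • hv x + hv y)
  (lv : (κ → ℝ) → ↥(pbox (towerTorus Lc (fine Lc M) (n + 1))) → ℝ)
  (hlv : ∀ (r : ℝ) (x y : κ → ℝ), lv (r • x + y) = r • lv x + lv y)
  (hJW : ∀ (a : κ) (b : ↥(pbox (towerTorus Lc (fine Lc M) (n + 1))) × Fin (3 + 1)), hv (Pi.single a 1) b
      = perF (towerTorus Lc (fine Lc M) (n + 1)) A (b.1, Sum.inl b.2)
          (wrapPt (towerTorus Lc (fine Lc M) (n + 1)) (((Lc ^ (n + 1 + 1) : ℕ) : ℤ) • yN a), Sum.inr (μN a))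
        - ∑ s : ↥(pbox (towerTorus Lc (fine Lc M) (n + 1))), tgrad (towerTorus Lc (fine Lc M) (n + 1)) (b.1, Sum.inl b.2) s * lv (Pi.single a 1) s)
  (𝔔₀ : Matrix ((↥(pbox M) × Fin (3 + 1))) (↥(pbox (towerTorus Lc (fine Lc M) (n + 1))) × Fin (3 + 1)) ℝ)
  (h𝔔₀' : 𝔔₀ = (compRowsSym Lc M (fun i : ℕ => n + 1 - (i - 1)) (fun _ : ℕ => ctrOff (3 + 1) Lc) (n + 1 + 1) :
      Matrix ((↥(pbox M) × Fin (3 + 1))) (↥(pbox (towerTorus Lc (fine Lc M) (n + 1))) × Fin (3 + 1)) ℝ))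
  (𝔔₁f : (κ → ℝ) → Matrix ((↥(pbox M) × Fin (3 + 1))) (↥(pbox (towerTorus Lc (fine Lc M) (n + 1))) × Fin (3 + 1)) ℝ)
  (h𝔔₁' : ∀ v, 𝔔₁f v = c • compIns₁Sym Lc M (fun i : ℕ => n + 1 - (i - 1)) (fun _ : ℕ => ctrOff (3 + 1) Lc) (n + 1 + 1) (hv v))
  (𝔔₂f : (κ → ℝ) → (κ → ℝ) → Matrix ((↥(pbox M) × Fin (3 + 1))) (↥(pbox (towerTorus Lc (fine Lc M) (n + 1))) × Fin (3 + 1)) ℝ)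
  (h𝔔₂' : ∀ v v', (1 / 2 : ℝ) • (𝔔₂f v v' + 𝔔₂f v' v)
    = c ^ 2 • compIns₂₂Sym Lc M (fun i : ℕ => n + 1 - (i - 1)) (fun _ : ℕ => ctrOff (3 + 1) Lc) (n + 1 + 1) (hv v) (hv v'))
  (Xbf : (κ → ℝ) → Matrix ((↥(pbox M) × Fin (3 + 1))) ((↥(pbox M) × Fin (3 + 1))) ℝ)
  (hXbf : ∀ v, Xbf v = c • Matrix.diagonal (fun a : (↥(pbox M) × Fin (3 + 1)) =>
    lv v (itRoot Lc M (fun _ : ℕ => ctrOff (3 + 1) Lc) (fun _ => hc) (n + 1 + 1) a.1)))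
  (𝔔'₂f : (κ → ℝ) → (κ → ℝ) → Matrix ((↥(pbox M) × Fin (3 + 1))) (↥(pbox (towerTorus Lc (fine Lc M) (n + 1))) × Fin (3 + 1)) ℝ)
  (h𝔔'₂f : ∀ v v', 𝔔'₂f v v' = Xbf v * Xbf v' * 𝔔₀ + (Xbf v * 𝔔₁f v' + Xbf v * 𝔔₀ * (-(c • Matrix.diagonal (fun b : (↥(pbox (towerTorus Lc (fine Lc M) (n + 1))) × Fin (3 + 1)) => lv v' b.1))))
      + ((Xbf v * 𝔔₁f v' + Xbf v * 𝔔₀ * (-(c • Matrix.diagonal (fun b : (↥(pbox (towerTorus Lc (fine Lc M) (n + 1))) × Fin (3 + 1)) => lv v' b.1)))) + (𝔔₂f v v' + 𝔔₁f v * (-(c • Matrix.diagonal (fun b : (↥(pbox (towerTorus Lc (fine Lc M) (n + 1))) × Fin (3 + 1)) => lv v' b.1))) + (𝔔₁f v * (-(c • Matrix.diagonal (fun b : (↥(pbox (towerTorus Lc (fine Lc M) (n + 1))) × Fin (3 + 1)) => lv v' b.1))) + 𝔔₀ * ((-(c • Matrix.diagonal (fun b : (↥(pbox (towerTorus Lc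 (fine Lc M) (n + 1))) × Fin (3 + 1)) => lv v b.1))) * (-(c • Matrix.diagonal (fun b : (↥(pbox (towerTorus Lc (fine Lc M) (n + 1))) × Fin (3 + 1)) => lv v' b.1))))))))
  (r : ℝ) (a a' : κ)
  -- THE SECOND-ORDER LOCK ROW on the free pin `Pn.cB (n+2)` (SPEC-54 §5; J-NOTE-11)
  (hcB : c ^ 2 * r * r * ∏ ℓ ∈ range (n + 1 + 1), (stepScale 3 Lc ℓ * ((box (3 + 1) Lc).card : ℝ)) = -(Pn.cB (n + 1 + 1)))

/-! ## §1 From a displayed single-orientation torus reading (PART 20's shape) -/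

omit [Fintype κ] in
include hfN hhvl hlv hJW h𝔔₀' h𝔔₁' h𝔔₂' hXbf h𝔔'₂f hcB in
/-- [folklore] **`hQN2_of_lock_of_readingA` — v5's ROW `hQN₂` AT THE LABEL PAIR `(μN a, yN a; μN a′, yN a′)`, PER BOX, FROM THE ROAD's DATA AND A DISPLAYED READING**: for #6's letters,
the slot map `fN`, the single-orientation torus reading `hWNμf` of the wound even family's multiplier–field block (the row's PART 20, displayed in its exact shape) and the lock `hcB`,
`½•(𝔔′₂f (r•e_a) (r•e_{a′}) + 𝔔′₂f (r•e_{a′}) (r•e_a)) = (perF T (dper T (x w ↦ Σ'_e WN♮ (μN a) (yN a) (μN a′) (translate M (yN a′) e) x w))).submatrix fN e_F`. -/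
theorem hQN2_of_lock_of_readingA
    (hWNμf : ∀ (p q : ↥(pbox (towerTorus Lc (fine Lc M) (n + 1)))) (m₁ β : Fin (3 + 1)),
      perF (towerTorus Lc (fine Lc M) (n + 1)) (dper (towerTorus Lc (fine Lc M) (n + 1))
          (fun X Z i₁ i₂ => ∑' e : Site (3 + 1), ((1 / 2 : ℝ) • (WNAG (Roots.ctr Lc) Pn A (n + 1) (μN a) (yN a) (μN a') (translate M (yN a') e)
            + sgnK (trK (WNAG (Roots.ctr Lc) Pn A (n + 1) (μN a) (yN a) (μN a') (translate M (yN a') e))))) X Z i₁ i₂)) (p, Sum.inr m₁) (q, Sum.inl β)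
        = -(Pn.cB (n + 1 + 1)) * (∑ b : ↥(pbox (towerTorus Lc (fine Lc M) (n + 1))) × Fin (3 + 1), ∑ b' : ↥(pbox (towerTorus Lc (fine Lc M) (n + 1))) × Fin (3 + 1),
          (perF (towerTorus Lc (fine Lc M) (n + 1)) A (b.1, Sum.inl b.2) (wrapPt (towerTorus Lc (fine Lc M) (n + 1)) (((Lc ^ (n + 1 + 1) : ℕ) : ℤ) • (yN a)), Sum.inr (μN a))
            * perF (towerTorus Lc (fine Lc M) (n + 1)) A (b'.1, Sum.inl b'.2) (wrapPt (towerTorus Lc (fine Lc M) (n + 1)) (((Lc ^ (n + 1 + 1) : ℕ) : ℤ) • (yN a')), Sum.inr (μN a')))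
            • perF (towerTorus Lc (fine Lc M) (n + 1)) (dper (towerTorus Lc (fine Lc M) (n + 1)) (fun x z a c => ∑' e : Site (3 + 1),
                (compVh2S (fun _ : ℕ => symLinKerAt (toSite (Roots.ctr Lc).r) Lc) (fun _ : ℕ => symVhKerAt (toSite (Roots.ctr Lc).r) Lc) (fun _ : ℕ => symVh2KerSymAt (toSite (Roots.ctr Lc).r) Lc) Lc (n + 1 + 1)) b.2 (b.1 : Site (3 + 1)) b'.2 (translate (towerTorus Lc (fine Lc M) (n + 1)) (b'.1 : Site (3 + 1)) e) x z a c)))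
          (p, Sum.inr m₁) (q, Sum.inl β)) :
    (1 / 2 : ℝ) • (𝔔'₂f (r • (Pi.single a (1 : ℝ) : κ → ℝ)) (r • (Pi.single a' (1 : ℝ) : κ → ℝ))
          + 𝔔'₂f (r • (Pi.single a' (1 : ℝ) : κ → ℝ)) (r • (Pi.single a (1 : ℝ) : κ → ℝ)))
      = (perF (towerTorus Lc (fine Lc M) (n + 1)) (dper (towerTorus Lc (fine Lc M) (n + 1))
          (fun X Z i₁ i₂ => ∑' e : Site (3 + 1), ((1 / 2 : ℝ) • (WNAG (Roots.ctr Lc) Pn A (n + 1) (μN a) (yN a) (μN a') (translate M (yN a') e)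
            + sgnK (trK (WNAG (Roots.ctr Lc) Pn A (n + 1) (μN a) (yN a) (μN a') (translate M (yN a') e))))) X Z i₁ i₂))).submatrix fN
          (fun b : ↥(pbox (towerTorus Lc (fine Lc M) (n + 1))) × Fin (3 + 1) => ((b.1, Sum.inl b.2) : Idx (towerTorus Lc (fine Lc M) (n + 1)) (Fib 3))) := by
  refine Matrix.ext fun p q => ?_
  obtain ⟨x, κ₀⟩ := p
  obtain ⟨z, β⟩ := q
  rw [Qprime2_symm_apply_eq_sum_sum_perF_dper_copiesA M n c A fN hfN hc yN μN hv hhvl lv hlv hJW 𝔔₀ h𝔔₀' 𝔔₁f h𝔔₁' 𝔔₂f h𝔔₂' Xbf hXbf 𝔔'₂f h𝔔'₂f r a a' x κ₀ z β,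
    Matrix.submatrix_apply, hfN (x, κ₀), hWNμf, ← hcB]
  simp only [Matrix.sum_apply, Matrix.smul_apply, smul_eq_mul]
  refine congrArg (HMul.hMul _) (Finset.sum_congr rfl fun b _ => Finset.sum_congr rfl fun b' _ => ?_)
  rw [mul_assoc]
  rfl

/-! ## §2 With the row's PART 20 consumed by name -/

omit [Fintype κ] in
include hfN hhvl hlv hJW h𝔔₀' h𝔔₁' h𝔔₂' hXbf h𝔔'₂f hcB hA hAσ hAt in
/-- [folklore] **`hQN2_of_lockA` — v5's ROW `hQN₂ n (μN a) (yN a) (μN a′) (yN a′) B` PER BOX IS A THEOREM AT THE ROAD's DATA MODULO THE LOCK ROW `hcB` ALONE**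
(`hQN2_of_lock_of_readingA` fed an2 PART 20 `NVertexEvenBorderTorus.perF_dper_wound_WN_evenHalf_inr_inl_eq_sum` at `hM := towerTorus_fine_apply M n`). -/
theorem hQN2_of_lockA :
    (1 / 2 : ℝ) • (𝔔'₂f (r • (Pi.single a (1 : ℝ) : κ → ℝ)) (r • (Pi.single a' (1 : ℝ) : κ → ℝ))
          + 𝔔'₂f (r • (Pi.single a' (1 : ℝ) : κ → ℝ)) (r • (Pi.single a (1 : ℝ) : κ → ℝ)))
      = (perF (towerTorus Lc (fine Lc M) (n + 1)) (dper (towerTorus Lc (fine Lc M) (n + 1))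
          (fun X Z i₁ i₂ => ∑' e : Site (3 + 1), ((1 / 2 : ℝ) • (WNAG (Roots.ctr Lc) Pn A (n + 1) (μN a) (yN a) (μN a') (translate M (yN a') e)
            + sgnK (trK (WNAG (Roots.ctr Lc) Pn A (n + 1) (μN a) (yN a) (μN a') (translate M (yN a') e))))) X Z i₁ i₂))).submatrix fN
          (fun b : ↥(pbox (towerTorus Lc (fine Lc M) (n + 1))) × Fin (3 + 1) => ((b.1, Sum.inl b.2) : Idx (towerTorus Lc (fine Lc M) (n + 1)) (Fib 3))) :=
  hQN2_of_lock_of_readingA M n c Pn A fN hfN hc yN μN hv hhvl lv hlv hJW 𝔔₀ h𝔔₀' 𝔔₁f h𝔔₁' 𝔔₂f h𝔔₂' Xbf hXbf 𝔔'₂f h𝔔'₂f r a a' hcB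
    (fun p q m₁ β => perF_dper_wound_WNAG_evenHalf_inr_inl_eq_sum (Roots.ctr Lc) Pn A (n + 1) hA hAσ hAt (towerTorus Lc (fine Lc M) (n + 1)) (towerTorus_fine_apply M n)
      (μN a) (yN a) (μN a') (yN a') p q m₁ β)

end Row

end Summit.QuantumFields.BalabanUV.Beta.FP.TowerEvenReadersChartGenericG.QN2Lock

namespace Summit.QuantumFields.BalabanUV.Beta.FP.TowerEvenReadersChartGenericG.CB

/-! ## 11f `TowerSigmaLegLetters` §3 cB bridges at `WNAG` -/

open Matrix Finset
open Literature.MathematicalPhysics.QuantumFieldTheory.Balaban1983to89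
open Literature.MathematicalPhysics.QuantumFieldTheory.Balaban1983to89.Beta
open Literature.MathematicalPhysics.QuantumFieldTheory.Balaban1983to89.Beta.HessKerRate (scaleK scaleK_apply)
open B4TorusKernel.MultiPeriod (translate)
open B6Lemma24Torus (pbox)
open AffineAveraging (Site)
open OneStepResolventKernel (Fib KInv)
open ExpKernelCalculus (MKer shiftK)
open BalabanStepJets (lamCoeffOf)
open Summit.QuantumFields.BalabanUV.Beta.BorderedHessian (stepScale stepScale_pos sgnK)
open Summit.QuantumFields.BalabanUV.Beta.TameKernelCalculus (trK)
open Summit.QuantumFields.BalabanUV.Beta.SymAveragingHessianCounts (symLinKerAt)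
open Summit.QuantumFields.BalabanUV.Beta.CompositeVertexKernelRec (compLinKer)
open Summit.QuantumFields.BalabanUV.Beta.FP.KernelPeriodisationFib (Idx perF perF_apply perZ_apply perF_scaleK_apply)
open Summit.QuantumFields.BalabanUV.Beta.FP.KernelPeriodisationFibLoc (dper dper_apply)
open Summit.QuantumFields.BalabanUV.Beta.FP.TorusGaugeCovariancePairing (wrapPt)
open Summit.QuantumFields.BalabanUV.Beta.FP.TorusCompositeObjects (towerTorus)
open Summit.QuantumFields.BalabanUV.Beta.CompositeOneShotJetData (Roots Pins AN VN WN)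
open Summit.QuantumFields.BalabanUV.Beta.NVertexParities (perF_dper_VN_inr)
open Summit.QuantumFields.BalabanUV.Beta.NVertexEvenBorderTorus (perF_dper_wound_WN_evenHalf_inr_inl_eq_sum)

open ExpKernelCalculus (MKer Decays shiftK VertexFamily₂)
open Summit.QuantumFields.BalabanUV.Beta.TameKernelCalculus (trK)
open Summit.QuantumFields.BalabanUV.Beta.BorderedHessian (sgnK)
open Summit.QuantumFields.BalabanUV.Beta.NVertexChartGenericObjectsG (WNAG)
open Summit.QuantumFields.BalabanUV.Beta.NVertexEvenChartGenericCarrierPeriodisedG (perF_dper_wound_WNAG_evenHalf_inr_inl_eq_sum)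

section Bridges

variable {Lc : ℕ} [NeZero Lc] (R : Roots Lc) (P P' : Pins) (A : MKer (3 + 1) (Fib 3)) (j : ℕ)
  (hA : ∃ δ C : ℝ, 0 < δ ∧ 0 ≤ C ∧ Decays A C δ) (hAσ : trK A = sgnK A) (hAt : ∀ t : Fin (3 + 1) → ℤ, shiftK (-(((Lc ^ (j + 1) : ℕ) : ℤ) • t)) A = A)
  (M : Fin (3 + 1) → ℕ) [∀ μ, NeZero (M μ)]


include hA hAσ hAt in
/-- [folklore] **the multiplier–field block of the periodised WOUND EVEN N-family scales with the border pin `cB`**: if `P′.cB (j+1) = t · P.cB (j+1)` (other pins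
arbitrary) then, on a box `M = Lc^(j+1)·M′`, the `(inr, inl)` entries of the periodised wound even families of `P′` and `P` differ by the factor `t`
(an2 PART 20 `perF_dper_wound_WN_evenHalf_inr_inl_eq_sum`: both are `−cB ·` the same pin-free double sum). -/
theorem perF_dper_woundEven_inr_inl_of_cBA {M' : Fin (3 + 1) → ℕ} (hM : ∀ i, M i = Lc ^ (j + 1) * M' i) {t : ℝ} (hP : P'.cB (j + 1) = t * P.cB (j + 1))
    (μ : Fin (3 + 1)) (y : Site (3 + 1)) (ν : Fin (3 + 1)) (y' : Site (3 + 1)) (p q : ↥(pbox M)) (m₁ β : Fin (3 + 1)) :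
    perF M (dper M (fun x w a b => ∑' e : Site (3 + 1),
        ((1 / 2 : ℝ) • (WNAG R P' A j μ y ν (translate M' y' e) + sgnK (trK (WNAG R P' A j μ y ν (translate M' y' e))))) x w a b)) (p, Sum.inr m₁) (q, Sum.inl β)
      = t * perF M (dper M (fun x w a b => ∑' e : Site (3 + 1),
        ((1 / 2 : ℝ) • (WNAG R P A j μ y ν (translate M' y' e) + sgnK (trK (WNAG R P A j μ y ν (translate M' y' e))))) x w a b)) (p, Sum.inr m₁) (q, Sum.inl β) := by
  rw [perF_dper_wound_WNAG_evenHalf_inr_inl_eq_sum R P' A j hA hAσ hAt M hM, perF_dper_wound_WNAG_evenHalf_inr_inl_eq_sum R P A j hA hAσ hAt M hM, hP]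
  ring

include hA hAσ hAt in
/-- [folklore] the same as the `(fN, ♭)` block (the `hQN₂` reading), `fN` landing in multiplier fibres. -/
theorem submatrix_perF_dper_woundEven_of_cBA {M' : Fin (3 + 1) → ℕ} (hM : ∀ i, M i = Lc ^ (j + 1) * M' i) {t : ℝ} (hP : P'.cB (j + 1) = t * P.cB (j + 1))
    {ι : Type*} (f : ι → Idx M (Fib 3)) (hf : ∀ a : ι, ∃ m : Fin (3 + 1), (f a).2 = Sum.inr m)
    (μ : Fin (3 + 1)) (y : Site (3 + 1)) (ν : Fin (3 + 1)) (y' : Site (3 + 1)) :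
    (perF M (dper M (fun x w a b => ∑' e : Site (3 + 1),
        ((1 / 2 : ℝ) • (WNAG R P' A j μ y ν (translate M' y' e) + sgnK (trK (WNAG R P' A j μ y ν (translate M' y' e))))) x w a b))).submatrix f
          (fun b : ↥(pbox M) × Fin (3 + 1) => ((b.1, Sum.inl b.2) : Idx M (Fib 3)))
      = t • (perF M (dper M (fun x w a b => ∑' e : Site (3 + 1),
        ((1 / 2 : ℝ) • (WNAG R P A j μ y ν (translate M' y' e) + sgnK (trK (WNAG R P A j μ y ν (translate M' y' e))))) x w a b))).submatrix f
          (fun b : ↥(pbox M) × Fin (3 + 1) => ((b.1, Sum.inl b.2) : Idx M (Fib 3))) := by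
  ext a b
  obtain ⟨m, hm⟩ := hf a
  have ha : f a = ((f a).1, Sum.inr m) := Prod.ext rfl hm
  simp only [Matrix.submatrix_apply, Matrix.smul_apply, smul_eq_mul]
  rw [ha]
  exact perF_dper_woundEven_inr_inl_of_cBA R P P' A j hA hAσ hAt M hM hP μ y ν y' _ _ m b.2


end Bridges

end Summit.QuantumFields.BalabanUV.Beta.FP.TowerEvenReadersChartGenericG.CB

namespace Summit.QuantumFields.BalabanUV.Beta.FP.TowerEvenReadersChartGenericG.WoundRows

/-! ## 11g `WoundEvenFamilyParities` §3 record rows at the chart family `A : ℕ → MKer` (v1.2: `A (n+1)`, σ = `AN R ↦ A`) -/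

open Literature.MathematicalPhysics.QuantumFieldTheory.Balaban1983to89
open Literature.MathematicalPhysics.QuantumFieldTheory.Balaban1983to89.Beta
open B4TorusKernel.MultiPeriod (translate)
open B5Prop11Plancherel (fine)
open B6Lemma24Torus (pbox)
open ExpKernelCalculus (MKer)
open OneStepResolventKernel (Fib)
open AffineAveraging (Site)
open Summit.QuantumFields.BalabanUV.Beta.TameKernelCalculus (trK trK_apply)
open Summit.QuantumFields.BalabanUV.Beta.BorderedHessian (sgnF sgnF_inl sgnF_inr sgnF_mul_self sgnK sgnK_apply)
open Summit.QuantumFields.BalabanUV.Beta.GAN24.SecondOrderReadersParity (parityEven_evenHalf)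
open Summit.QuantumFields.BalabanUV.Beta.FP.KernelPeriodisationFib (Idx perF perF_apply perZ_apply)
open Summit.QuantumFields.BalabanUV.Beta.FP.KernelPeriodisationFibLoc (dper dper_apply dper_translate)
open Summit.QuantumFields.BalabanUV.Beta.FP.SecondOrderTableEvenPart (dper_trK dper_sgnK perF_trK_apply perF_sgnK_apply)
open Summit.QuantumFields.BalabanUV.Beta.FP.TorusCompositeObjects (towerTorus)
open Summit.QuantumFields.BalabanUV.Beta.CompositeOneShotJetData (Roots Pins WN)
open Summit.QuantumFields.BalabanUV.Beta.NVertexParitiesW (WN_inr_inr)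

open ExpKernelCalculus (MKer Decays shiftK VertexFamily₂)
open Summit.QuantumFields.BalabanUV.Beta.TameKernelCalculus (trK)
open Summit.QuantumFields.BalabanUV.Beta.BorderedHessian (sgnK)
open Summit.QuantumFields.BalabanUV.Beta.NVertexChartGenericObjectsG (WNAG)
open Summit.QuantumFields.BalabanUV.Beta.NVertexEvenChartGenericBorderG (WNAG_inr_inr)
open Summit.QuantumFields.BalabanUV.Beta.FP.WoundEvenFamilyParities (parityEven_tsum inr_inr_tsum_eq_zero inr_inr_evenHalf_eq_zero perF_dper_apply_eq_zero_of_inr_inr perF_dper_antitwin_fμ_of_parityEven)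

section Record

variable {Lc : ℕ} [NeZero Lc] (Mc : ℕ → (Fin (3 + 1) → ℕ)) (Pn : Pins) (A : ℕ → MKer (3 + 1) (Fib 3))
  (fN : ∀ n : ℕ, ∀ B : ℕ, (↥(pbox (Mc B)) × Fin (3 + 1)) → Idx (towerTorus Lc (fine Lc (Mc B)) (n + 1)) (Fib 3))
  (hmN : ∀ n : ℕ, ∀ B : ℕ, ∀ a : (↥(pbox (Mc B)) × Fin (3 + 1)), ∃ m : Fin (3 + 1), ((fN n) B a).2 = Sum.inr m)

/-- [folklore] the wound even N-family `x z a b ↦ Σ' e, (WN … μ y ν (y′ + Mc∘e))♮ x z a b` is graded-even (§1 `parityEven_tsum` over GAN24 `parityEven_evenHalf`). -/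
theorem WN_evenHalf_wound_parityEvenA (n : ℕ) (μ : Fin (3 + 1)) (y : Site (3 + 1)) (ν : Fin (3 + 1)) (y' : Site (3 + 1)) (B : ℕ) :
    trK (fun x z a b => ∑' e : Site (3 + 1), ((1 / 2 : ℝ) • (WNAG (Roots.ctr Lc) Pn (A (n + 1)) (n + 1) μ y ν (translate (Mc B) y' e)
          + sgnK (trK (WNAG (Roots.ctr Lc) Pn (A (n + 1)) (n + 1) μ y ν (translate (Mc B) y' e))))) x z a b)
      = sgnK (fun x z a b => ∑' e : Site (3 + 1), ((1 / 2 : ℝ) • (WNAG (Roots.ctr Lc) Pn (A (n + 1)) (n + 1) μ y ν (translate (Mc B) y' e)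
          + sgnK (trK (WNAG (Roots.ctr Lc) Pn (A (n + 1)) (n + 1) μ y ν (translate (Mc B) y' e))))) x z a b) :=
  parityEven_tsum _ fun _ => parityEven_evenHalf _

/-- [folklore] … and has zero `μμ` block pointwise (an2 `NVertexParitiesW.WNAG_inr_inr` termwise). -/
theorem WN_evenHalf_wound_inr_inrA (n : ℕ) (μ : Fin (3 + 1)) (y : Site (3 + 1)) (ν : Fin (3 + 1)) (y' : Site (3 + 1)) (B : ℕ)
    (x z : Site (3 + 1)) (m m' : Fin (3 + 1)) :
    (fun x z a b => ∑' e : Site (3 + 1), ((1 / 2 : ℝ) • (WNAG (Roots.ctr Lc) Pn (A (n + 1)) (n + 1) μ y ν (translate (Mc B) y' e)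
          + sgnK (trK (WNAG (Roots.ctr Lc) Pn (A (n + 1)) (n + 1) μ y ν (translate (Mc B) y' e))))) x z a b) x z (Sum.inr m) (Sum.inr m') = 0 :=
  inr_inr_tsum_eq_zero _ (fun e x' z' m₁ m₂ => inr_inr_evenHalf_eq_zero
      (fun x'' z'' m₃ m₄ => WNAG_inr_inr (Roots.ctr Lc) Pn (A (n + 1)) (n + 1) μ y ν (translate (Mc B) y' e) x'' z'' m₃ m₄) x' z' m₁ m₂)
    x z m m'

include hmN in
/-- [folklore] **`hWNm_rows_woundA` — THE v5 ROW `hWNm` FOR THE WOUND EVEN N-FAMILY, A THEOREM**: on two N-leg indices the periodised wound even family vanishes, at every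
depth, label pair and box (§2, no decay letter). -/
theorem hWNm_rows_woundA :
    ∀ (n : ℕ) (μ : Fin (3 + 1)) (y : Fin (3 + 1) → ℤ) (ν : Fin (3 + 1)) (y' : Fin (3 + 1) → ℤ), ∀ B : ℕ, ∀ a a' : (↥(pbox (Mc B)) × Fin (3 + 1)),
    (perF (towerTorus Lc (fine Lc (Mc B)) (n + 1)) (dper (towerTorus Lc (fine Lc (Mc B)) (n + 1))
        (fun x z a b => ∑' e : Site (3 + 1), ((1 / 2 : ℝ) • (WNAG (Roots.ctr Lc) Pn (A (n + 1)) (n + 1) μ y ν (translate (Mc B) y' e)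
          + sgnK (trK (WNAG (Roots.ctr Lc) Pn (A (n + 1)) (n + 1) μ y ν (translate (Mc B) y' e))))) x z a b))) (((fN n) B) a) (((fN n) B) a') = 0 :=
  fun n μ y ν y' B a a' =>
    perF_dper_apply_eq_zero_of_inr_inr _ ((fN n) B) ((hmN n) B) (fun x z m m' => WN_evenHalf_wound_inr_inrA Mc Pn A n μ y ν y' B x z m m') a a'

include hmN in
/-- [folklore] **`hWNt_rows_woundA` — THE v5 ROW `hWNt` FOR THE WOUND EVEN N-FAMILY, A THEOREM**: the ANTI-twin (field, multiplier) border of the periodised wound even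
family, at every depth, label pair and box (§1, no decay letter). -/
theorem hWNt_rows_woundA :
    ∀ (n : ℕ) (μ : Fin (3 + 1)) (y : Fin (3 + 1) → ℤ) (ν : Fin (3 + 1)) (y' : Fin (3 + 1) → ℤ), ∀ B : ℕ,
    ∀ (b : (↥(pbox (towerTorus Lc (fine Lc (Mc B)) (n + 1))) × Fin (3 + 1))) (a : (↥(pbox (Mc B)) × Fin (3 + 1))),
    (perF (towerTorus Lc (fine Lc (Mc B)) (n + 1)) (dper (towerTorus Lc (fine Lc (Mc B)) (n + 1))
        (fun x z a b => ∑' e : Site (3 + 1), ((1 / 2 : ℝ) • (WNAG (Roots.ctr Lc) Pn (A (n + 1)) (n + 1) μ y ν (translate (Mc B) y' e)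
          + sgnK (trK (WNAG (Roots.ctr Lc) Pn (A (n + 1)) (n + 1) μ y ν (translate (Mc B) y' e))))) x z a b))) (b.1, Sum.inl b.2) (((fN n) B) a)
      = -(perF (towerTorus Lc (fine Lc (Mc B)) (n + 1)) (dper (towerTorus Lc (fine Lc (Mc B)) (n + 1))
        (fun x z a b => ∑' e : Site (3 + 1), ((1 / 2 : ℝ) • (WNAG (Roots.ctr Lc) Pn (A (n + 1)) (n + 1) μ y ν (translate (Mc B) y' e)
          + sgnK (trK (WNAG (Roots.ctr Lc) Pn (A (n + 1)) (n + 1) μ y ν (translate (Mc B) y' e))))) x z a b))) (((fN n) B) a) (b.1, Sum.inl b.2) :=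
  fun n μ y ν y' B b a =>
    perF_dper_antitwin_fμ_of_parityEven _ ((fN n) B) ((hmN n) B) (WN_evenHalf_wound_parityEvenA Mc Pn A n μ y ν y' B) b a

end Record

end Summit.QuantumFields.BalabanUV.Beta.FP.TowerEvenReadersChartGenericG.WoundRows

end
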